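import Mathlib
import Literature.MathematicalPhysics.QuantumLattice.EuclideanAction
import HarnessLib

/-!
# Transverse smearing transports everything to the plane (stub `stub_smearTransport`,
crux `ShellRigidity`, line `transverse-smearing-planar-threshold`, stmt-QuantumFields-11685)

Let `K : ℝ⁴ → ℝ` be continuous off `0` with `|K w| ≤ C (1 + ‖w‖ ^ (η - 10))`, `η < 8`,
invariant under the swap of the coordinates `0, 1` and under the sign change of each of them,
and with, for every `ε > 0`, a finite measure `μ_ε` on `ℝ⁴` null on `{p₀ < 0}` such that
`K((ε + t) e₀ + a) = ∫ e^{-t p₀ + i⟨a, p⟩} dμ_ε` (`t ≥ 0`, `a ⊥ e₀`). For a real `h ∈ C_c(ℝ²)`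
put `F(x) = ∫∫ h(y) h(y') K(x₁, x₂, y - y') dy dy'`. Then (1) `F` is continuous off `0`;
(2) `|F x| ≤ C' (1 + (x₁² + x₂²) ^ (-(8 - η)/2))` off `0`; (3) `F(t,s) = F(s,t) = F(t,-s) =
F(-t,s)`; (4) for every `ε > 0` there is a finite measure `ν_ε` null on `{p₀ < 0}` with
`F(ε + t, b) = ∫ e^{-t p₀ + i b p₁} dν_ε` (`t ≥ 0`, `b ∈ ℝ`).

Proof (folklore, Mathlib only). (1) parametric integrals of continuous, uniformly compactly
supported integrands, twice (`continuousOn_integral_of_compact_support`). (2)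
`|F x| ≤ C‖h‖₁² + C‖h‖∞‖h‖₁ ∫ (ρ² + |z|²)^(-a) dz`, `a = (10 - η)/2 > 1`, and the `dz`-integral
is `ρ^(2-2a) ∫ (1 + |w|²)^(-a) dw` (scaling, `Measure.integral_comp_inv_smul_of_nonneg`), finite
as `2a > 2 = dim ℝ²` (`integrable_rpow_neg_one_add_norm_sq`). (3) pointwise in the integrand.
(4) `K(ε+t, b, y-y') = ∫ Φ e_y conj(e_{y'}) dμ_ε` with `Φ(p) = e^{-t p₀ + i b p₁}`,
`e_y(p) = e^{i(y₁ p₂ + y₂ p₃)}`; Fubini twice (`integral_integral_swap`, domination by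
`|h y| |h y'|` since `|Φ| ≤ 1` `μ_ε`-a.e.) gives `F(ε+t, b) = ∫ Φ |ĥ|² dμ_ε`,
`ĥ(p) = ∫ h(y) e_y(p) dy` (`integral_conj`); so `ν_ε = |ĥ|² · μ_ε` (`Measure.withDensity`;
`ĥ` is continuous with `|ĥ| ≤ ‖h‖₁`, hence `ν_ε` is finite, and `ν_ε ≪ μ_ε`).
-/
noncomputable section

namespace Summit.QuantumFields.YangMills.Cruxes.ShellRigidity.TransverseSmearingPlanarThreshold

open MeasureTheory Complex
open scoped BigOperators InnerProductSpace ComplexConjugate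

namespace SmearTransport

/-- If the planar part `x` is nonzero, the point `(x, c, d) ∈ ℝ⁴` is nonzero. -/
theorem pt_ne_zero {x : ℝ × ℝ} (hx : x ≠ 0) (c d : ℝ) :
    (WithLp.toLp 2 ![x.1, x.2, c, d] : EuclideanSpace ℝ (Fin 4)) ≠ 0 := fun h0 =>
  hx (Prod.ext (by simpa using congrArg (fun v : EuclideanSpace ℝ (Fin 4) => v 0) h0)
    (by simpa using congrArg (fun v : EuclideanSpace ℝ (Fin 4) => v 1) h0))

/-- The crux bound `|K w| ≤ C (1 + ‖w‖ ^ (η - 10))` at `w = (x, z)`, `x ≠ 0`, in planar `rpow`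
form (`‖w‖ = √(|x|² + |z|²)`). -/
theorem kernel_bound_pt {K : EuclideanSpace ℝ (Fin 4) → ℝ} {η C : ℝ}
    (hb : ∀ w : EuclideanSpace ℝ (Fin 4), w ≠ 0 → |K w| ≤ C * (1 + ‖w‖ ^ (η - 10)))
    {x : ℝ × ℝ} (hx : x ≠ 0) (z : ℝ × ℝ) :
    |K (WithLp.toLp 2 ![x.1, x.2, z.1, z.2])| ≤
      C * (1 + (x.1 ^ 2 + x.2 ^ 2 + z.1 ^ 2 + z.2 ^ 2) ^ (-((10 - η) / 2))) := by
  have h := hb _ (pt_ne_zero hx z.1 z.2)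
  have hn : ‖(WithLp.toLp 2 ![x.1, x.2, z.1, z.2] : EuclideanSpace ℝ (Fin 4))‖ =
      Real.sqrt (x.1 ^ 2 + x.2 ^ 2 + z.1 ^ 2 + z.2 ^ 2) := by
    rw [EuclideanSpace.norm_eq]
    simp [Fin.sum_univ_four]
  rw [hn, Real.sqrt_eq_rpow, ← Real.rpow_mul (by positivity)] at h
  rwa [show (1 : ℝ) / 2 * (η - 10) = -((10 - η) / 2) by ring] at h

/-- The point `(u, b, c, d)` is `u e₀` plus the purely spatial vector `(0, b, c, d)`. -/
theorem pt_eq_single_add (u b c d : ℝ) : (WithLp.toLp 2 ![u, b, c, d] : EuclideanSpace ℝ (Fin 4))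
    = EuclideanSpace.single 0 u + WithLp.toLp 2 ![0, b, c, d] := by
  ext i
  fin_cases i <;> simp

/-- The inner product of the spatial vector `(0, b, c, d)` with `p`. -/
theorem inner_pt0 (b c d : ℝ) (p : EuclideanSpace ℝ (Fin 4)) :
    ⟪(WithLp.toLp 2 ![0, b, c, d] : EuclideanSpace ℝ (Fin 4)), p⟫_ℝ =
      b * p 1 + c * p 2 + d * p 3 := by
  simp [PiLp.inner_apply, Fin.sum_univ_four]
  ring

/-- **(1) Continuity of the smear off `0`** (two parametric integrals with continuous, uniformly
compactly supported integrands; the kernel argument stays off `0`). -/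
theorem smear_continuousOn (K : EuclideanSpace ℝ (Fin 4) → ℝ) (hc : ContinuousOn K {x | x ≠ 0})
    (h : ℝ × ℝ → ℝ) (hh : Continuous h) (hhs : HasCompactSupport h) :
    ContinuousOn (fun x : ℝ × ℝ => ∫ y : ℝ × ℝ, ∫ y' : ℝ × ℝ,
      h y * h y' * K (WithLp.toLp 2 ![x.1, x.2, (y - y').1, (y - y').2])) {x | x ≠ 0} := by
  have hin : ContinuousOn (fun q : (ℝ × ℝ) × (ℝ × ℝ) => ∫ y' : ℝ × ℝ,
      h q.2 * h y' * K (WithLp.toLp 2 ![q.1.1, q.1.2, (q.2 - y').1, (q.2 - y').2]))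
      ({x : ℝ × ℝ | x ≠ 0} ×ˢ Set.univ) := by
    refine continuousOn_integral_of_compact_support (k := tsupport h) hhs (ContinuousOn.mul
      (by fun_prop) (hc.comp (by fun_prop : Continuous fun p : ((ℝ × ℝ) × (ℝ × ℝ)) × (ℝ × ℝ) =>
        (WithLp.toLp 2 ![p.1.1.1, p.1.1.2, (p.1.2 - p.2).1, (p.1.2 - p.2).2] :
          EuclideanSpace ℝ (Fin 4))).continuousOn fun p hp => ?_)) fun q y' _ hy' => ?_
    · simp only [Set.mem_prod, Set.mem_univ, and_true, Set.mem_setOf_eq] at hp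
      exact pt_ne_zero hp _ _
    · simp [image_eq_zero_of_notMem_tsupport hy']
  exact continuousOn_integral_of_compact_support (k := tsupport h) hhs hin fun x y _ hy => by
    simp [image_eq_zero_of_notMem_tsupport hy]

/-- `(1 + |w|²) ^ (-a)` is integrable on `ℝ²` for `a > 1` (comparison with `(1 + ‖w‖²) ^ (-a)`
for the sup norm and `integrable_rpow_neg_one_add_norm_sq`, `2a > 2 = dim`). -/
theorem integrable_J {a : ℝ} (ha : 1 < a) :
    Integrable (fun w : ℝ × ℝ => (1 + w.1 ^ 2 + w.2 ^ 2) ^ (-a)) := by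
  have h := integrable_rpow_neg_one_add_norm_sq (E := ℝ × ℝ) (μ := volume) (r := 2 * a)
    (by norm_num [Module.finrank_prod]; linarith)
  refine h.mono' (Continuous.rpow_const (by fun_prop) fun w =>
    Or.inl (by positivity)).aestronglyMeasurable (ae_of_all _ fun w => ?_)
  rw [Real.norm_eq_abs, abs_of_nonneg (by positivity), show -(2 * a) / 2 = -a by ring]
  have h1 : ‖w‖ ^ 2 ≤ w.1 ^ 2 + w.2 ^ 2 := by
    rcases max_cases |w.1| |w.2| with ⟨h, -⟩ | ⟨h, -⟩ <;>
      rw [Prod.norm_def, Real.norm_eq_abs, Real.norm_eq_abs, h, sq_abs] <;>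
      nlinarith [sq_nonneg w.1, sq_nonneg w.2]
  exact Real.rpow_le_rpow_of_nonpos (by positivity) (by linarith) (by linarith)

/-- The scaling identity `(r + |z|²)^(-a) = r^(-a) (1 + |z/√r|²)^(-a)`, `r > 0`. -/
theorem scale_identity (a : ℝ) {r : ℝ} (hr : 0 < r) (z : ℝ × ℝ) :
    (r + z.1 ^ 2 + z.2 ^ 2) ^ (-a) =
      r ^ (-a) * (1 + ((Real.sqrt r)⁻¹ • z).1 ^ 2 + ((Real.sqrt r)⁻¹ • z).2 ^ 2) ^ (-a) := by
  have hS : 0 ≤ r + z.1 ^ 2 + z.2 ^ 2 := by positivity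
  have h1 : 1 + ((Real.sqrt r)⁻¹ • z).1 ^ 2 + ((Real.sqrt r)⁻¹ • z).2 ^ 2 =
      r⁻¹ * (r + z.1 ^ 2 + z.2 ^ 2) := by
    simp only [Prod.smul_fst, Prod.smul_snd, smul_eq_mul, mul_pow, inv_pow, Real.sq_sqrt hr.le]
    field_simp
  rw [h1, Real.mul_rpow (inv_nonneg.2 hr.le) hS, ← mul_assoc, Real.inv_rpow hr.le,
    mul_inv_cancel₀ (Real.rpow_pos_of_pos hr _).ne', one_mul]

/-- Translation and scaling (`z = y - √r • w`; Lebesgue measure on `ℝ²` is an additive Haar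
measure, `finrank ℝ ℝ² = 2`): for `r > 0`, `a > 1`, `z ↦ (r + |y - z|²)^(-a)` is integrable and
`∫ (r + |y - z|²)^(-a) dz = r^(1-a) ∫ (1 + |w|²)^(-a) dw`. -/
theorem integral_rpow_transl {a : ℝ} (ha : 1 < a) {r : ℝ} (hr : 0 < r) (y : ℝ × ℝ) :
    Integrable (fun z : ℝ × ℝ => (r + (y - z).1 ^ 2 + (y - z).2 ^ 2) ^ (-a)) ∧
      ∫ z : ℝ × ℝ, (r + (y - z).1 ^ 2 + (y - z).2 ^ 2) ^ (-a) =
        r ^ (1 - a) * ∫ w : ℝ × ℝ, (1 + w.1 ^ 2 + w.2 ^ 2) ^ (-a) := by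
  have hρ : 0 < Real.sqrt r := Real.sqrt_pos.2 hr
  refine ⟨?_, ?_⟩
  · have h1 : Integrable (fun z : ℝ × ℝ => (r + z.1 ^ 2 + z.2 ^ 2) ^ (-a)) := by
      simp_rw [scale_identity a hr]
      exact ((integrable_J ha).comp_smul (inv_ne_zero hρ.ne')).const_mul _
    exact h1.comp_sub_left y
  rw [integral_sub_left_eq_self (fun z : ℝ × ℝ => (r + z.1 ^ 2 + z.2 ^ 2) ^ (-a)) volume y]
  simp_rw [scale_identity a hr]
  rw [integral_const_mul, Measure.integral_comp_inv_smul_of_nonneg volume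
    (fun w : ℝ × ℝ => (1 + w.1 ^ 2 + w.2 ^ 2) ^ (-a)) hρ.le]
  simp only [Module.finrank_prod, Module.finrank_self, Nat.reduceAdd, smul_eq_mul,
    Real.sq_sqrt hr.le]
  rw [← mul_assoc, sub_eq_add_neg, Real.rpow_add hr, Real.rpow_one, mul_comm (r ^ (-a))]

/-- **Inner estimate.** For `x ≠ 0`, `r = x₁² + x₂²`, `a = (10 - η)/2`:
`|∫ h y h y' K(x, y - y') dy'| ≤ |h y| (C‖h‖₁ + C M r^(1-a) J)` (`|h| ≤ M`,
`J = ∫ (1 + |w|²)^(-a) dw`), from the pointwise kernel bound and `integral_rpow_transl`. -/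
theorem inner_bound {K : EuclideanSpace ℝ (Fin 4) → ℝ} {η C M : ℝ} (hη8 : η < 8) (hC : 0 ≤ C)
    (hb : ∀ w : EuclideanSpace ℝ (Fin 4), w ≠ 0 → |K w| ≤ C * (1 + ‖w‖ ^ (η - 10)))
    {h : ℝ × ℝ → ℝ} (hh : Continuous h) (hhs : HasCompactSupport h) (hM : ∀ y, |h y| ≤ M)
    {x : ℝ × ℝ} (hx : x ≠ 0) (y : ℝ × ℝ) :
    |∫ y' : ℝ × ℝ, h y * h y' * K (WithLp.toLp 2 ![x.1, x.2, (y - y').1, (y - y').2])| ≤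
      |h y| * (C * (∫ y' : ℝ × ℝ, |h y'|) +
        C * M * ((x.1 ^ 2 + x.2 ^ 2) ^ (1 - (10 - η) / 2) *
          ∫ w : ℝ × ℝ, (1 + w.1 ^ 2 + w.2 ^ 2) ^ (-((10 - η) / 2)))) := by
  set a := (10 - η) / 2 with ha_def
  have ha : 1 < a := by rw [ha_def]; linarith
  have hr : 0 < x.1 ^ 2 + x.2 ^ 2 := by
    rcases ne_or_eq x.1 0 with h1 | h1
    · positivity
    · have h2 : x.2 ≠ 0 := fun h2 => hx (Prod.ext h1 h2)
      positivity
  set r := x.1 ^ 2 + x.2 ^ 2 with hr_def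
  have hint : Integrable h := hh.integrable_of_hasCompactSupport hhs
  obtain ⟨hti, htv⟩ := integral_rpow_transl ha hr y
  refine abs_integral_le_integral_abs.trans ((integral_mono_of_nonneg
    (ae_of_all _ fun _ => abs_nonneg _) (((hint.abs.const_mul (C * |h y|))).add
      (hti.const_mul (C * M * |h y|))) (ae_of_all _ fun y' => ?_)).trans_eq ?_)
  · have hK := kernel_bound_pt hb hx (y - y')
    have hS : 0 ≤ (r + (y - y').1 ^ 2 + (y - y').2 ^ 2) ^ (-a) := by positivity
    simp only [Pi.add_apply, abs_mul]
    nlinarith [mul_le_mul_of_nonneg_left hK (mul_nonneg (abs_nonneg (h y)) (abs_nonneg (h y'))),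
      mul_le_mul_of_nonneg_left (hM y') (mul_nonneg (mul_nonneg hC (abs_nonneg (h y))) hS)]
  · rw [integral_add' ((hint.abs.const_mul _)) (hti.const_mul _), integral_const_mul,
      integral_const_mul, htv]
    ring

/-- **(2) Order drop of the smear**: `|F x| ≤ C' (1 + (x₁² + x₂²) ^ (-(8 - η)/2))` off `0`, with
`C' = C‖h‖₁² + C M J ‖h‖₁` (`C ↦ max C 0`; the inner estimate integrated against `|h y| dy`). -/
theorem smear_bound (K : EuclideanSpace ℝ (Fin 4) → ℝ) (η : ℝ) (hη8 : η < 8)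
    (hb : ∃ C : ℝ, ∀ x : EuclideanSpace ℝ (Fin 4), x ≠ 0 → |K x| ≤ C * (1 + ‖x‖ ^ (η - 10)))
    (h : ℝ × ℝ → ℝ) (hh : Continuous h) (hhs : HasCompactSupport h) :
    ∃ C : ℝ, ∀ x : ℝ × ℝ, x ≠ 0 →
      |∫ y : ℝ × ℝ, ∫ y' : ℝ × ℝ,
          h y * h y' * K (WithLp.toLp 2 ![x.1, x.2, (y - y').1, (y - y').2])| ≤
        C * (1 + (x.1 ^ 2 + x.2 ^ 2) ^ (-((8 - η) / 2))) := by
  obtain ⟨C₀, hC₀⟩ := hb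
  set C := max C₀ 0 with hC_def
  have hC : 0 ≤ C := le_max_right _ _
  have hb' : ∀ w : EuclideanSpace ℝ (Fin 4), w ≠ 0 → |K w| ≤ C * (1 + ‖w‖ ^ (η - 10)) :=
    fun w hw => (hC₀ w hw).trans (mul_le_mul_of_nonneg_right (le_max_left _ _) (by positivity))
  obtain ⟨M, hM⟩ := hh.bounded_above_of_compact_support hhs
  have hM' : ∀ y, |h y| ≤ M := fun y => by simpa [Real.norm_eq_abs] using hM y
  have hM0 : 0 ≤ M := (abs_nonneg _).trans (hM' 0)
  have hint : Integrable h := hh.integrable_of_hasCompactSupport hhs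
  set L1 := ∫ y : ℝ × ℝ, |h y| with hL1_def
  set J := ∫ w : ℝ × ℝ, (1 + w.1 ^ 2 + w.2 ^ 2) ^ (-((10 - η) / 2)) with hJ_def
  have hL1 : 0 ≤ L1 := integral_nonneg fun _ => abs_nonneg _
  have hJ : 0 ≤ J := integral_nonneg fun _ => by positivity
  refine ⟨C * L1 * L1 + C * M * J * L1, fun x hx => ?_⟩
  have hexp : (x.1 ^ 2 + x.2 ^ 2) ^ (1 - (10 - η) / 2) =
      (x.1 ^ 2 + x.2 ^ 2) ^ (-((8 - η) / 2)) := by congr 1; ring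
  have hρ : 0 ≤ (x.1 ^ 2 + x.2 ^ 2) ^ (-((8 - η) / 2)) := by positivity
  have h1 : 0 ≤ C * L1 * L1 := by positivity
  have h2 : 0 ≤ C * M * J * L1 := by positivity
  calc |∫ y : ℝ × ℝ, ∫ y' : ℝ × ℝ,
          h y * h y' * K (WithLp.toLp 2 ![x.1, x.2, (y - y').1, (y - y').2])|
      ≤ ∫ y : ℝ × ℝ, |h y| * (C * L1 + C * M * ((x.1 ^ 2 + x.2 ^ 2) ^ (1 - (10 - η) / 2) * J)) :=
        abs_integral_le_integral_abs.trans (integral_mono_of_nonneg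
          (ae_of_all _ fun _ => abs_nonneg _) (hint.abs.mul_const _)
          (ae_of_all _ fun y => inner_bound hη8 hC hb' hh hhs hM' hx y))
    _ = C * L1 * L1 + C * M * J * L1 * (x.1 ^ 2 + x.2 ^ 2) ^ (-((8 - η) / 2)) := by
        rw [integral_mul_const, hexp]
        ring
    _ ≤ _ := by nlinarith

/-- The transform `p ↦ ∫ h(y) e_y(p) dy` of `h ∈ C_c(ℝ²)` against continuous unimodular phases
is continuous (`continuousOn_integral_of_compact_support`) and bounded by `‖h‖₁`. -/
theorem transform_continuous {e : ℝ × ℝ → EuclideanSpace ℝ (Fin 4) → ℂ}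
    (he : Continuous fun q : (ℝ × ℝ) × EuclideanSpace ℝ (Fin 4) => e q.1 q.2)
    (he1 : ∀ y p, ‖e y p‖ = 1) {h : ℝ × ℝ → ℝ} (hh : Continuous h) (hhs : HasCompactSupport h) :
    (Continuous fun p : EuclideanSpace ℝ (Fin 4) => ∫ y : ℝ × ℝ, (h y : ℂ) * e y p) ∧
      ∀ p, ‖∫ y : ℝ × ℝ, (h y : ℂ) * e y p‖ ≤ ∫ y : ℝ × ℝ, |h y| := by
  refine ⟨?_, fun p => (norm_integral_le_integral_norm _).trans_eq (by simp [he1])⟩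
  rw [← continuousOn_univ]
  refine continuousOn_integral_of_compact_support (k := tsupport h) hhs
    ((continuous_ofReal.comp (hh.comp continuous_snd)).mul
      (he.comp (continuous_snd.prodMk continuous_fst))).continuousOn fun p y _ hy => ?_
  simp [image_eq_zero_of_notMem_tsupport hy]

/-- **Fubini core.** For a finite measure `μ` on `ℝ⁴`, a continuous `Φ` with `‖Φ‖ ≤ 1` `μ`-a.e.,
continuous unimodular phases `e_y(p)` and a real `h ∈ C_c(ℝ²)`:
`∫∫∫ h y h y' Φ e_y conj(e_{y'}) dμ dy' dy = ∫ Φ ‖∫ h y e_y dy‖² dμ` (`integral_integral_swap`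
twice, dominations `|h y| |h y'|`, `|h y| ‖h‖₁` on `ℝ² × μ`; then `integral_conj` and
`conj z * z = ‖z‖²`). -/
theorem fubini_core (μ : Measure (EuclideanSpace ℝ (Fin 4))) [IsFiniteMeasure μ]
    {Φ : EuclideanSpace ℝ (Fin 4) → ℂ} (hΦc : Continuous Φ) (hΦb : ∀ᵐ p ∂μ, ‖Φ p‖ ≤ 1)
    {e : ℝ × ℝ → EuclideanSpace ℝ (Fin 4) → ℂ}
    (he : Continuous fun q : (ℝ × ℝ) × EuclideanSpace ℝ (Fin 4) => e q.1 q.2)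
    (he1 : ∀ y p, ‖e y p‖ = 1) {h : ℝ × ℝ → ℝ} (hh : Continuous h)
    (hhs : HasCompactSupport h) :
    (∫ y : ℝ × ℝ, ∫ y' : ℝ × ℝ, ∫ p,
        (h y : ℂ) * (h y' : ℂ) * (Φ p * e y p * conj (e y' p)) ∂μ) =
      ∫ p, Φ p * ((‖∫ y : ℝ × ℝ, (h y : ℂ) * e y p‖ ^ 2 : ℝ) : ℂ) ∂μ := by
  have hint : Integrable h := hh.integrable_of_hasCompactSupport hhs
  obtain ⟨hgc, hgb⟩ := transform_continuous he he1 hh hhs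
  have hae1 : ∀ᵐ z : (ℝ × ℝ) × EuclideanSpace ℝ (Fin 4) ∂(volume.prod μ), ‖Φ z.2‖ ≤ 1 :=
    (Measure.quasiMeasurePreserving_snd (μ := volume) (ν := μ)).ae hΦb
  have hI1 : ∀ y : ℝ × ℝ, Integrable (Function.uncurry fun (y' : ℝ × ℝ) p =>
      (h y : ℂ) * (h y' : ℂ) * (Φ p * e y p * conj (e y' p))) (volume.prod μ) := by
    intro y
    refine Integrable.mono' ((hint.abs.const_mul |h y|).mul_prod (integrable_const (1 : ℝ)))
      ((continuous_const.mul (continuous_ofReal.comp (hh.comp continuous_fst))).mul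
        (((hΦc.comp continuous_snd).mul (he.comp (continuous_const.prodMk continuous_snd))).mul
          (continuous_conj.comp he))).aestronglyMeasurable ?_
    filter_upwards [hae1] with ⟨y', p⟩ hz
    simp only [Function.uncurry_apply_pair, norm_mul, Complex.norm_real, Real.norm_eq_abs, he1,
      Complex.norm_conj, mul_one]
    exact mul_le_of_le_one_right (by positivity) hz
  have hI2 : Integrable (Function.uncurry fun (y : ℝ × ℝ) p =>
      (h y : ℂ) * Φ p * e y p * conj (∫ y' : ℝ × ℝ, (h y' : ℂ) * e y' p)) (volume.prod μ) := by
    refine Integrable.mono' (hint.abs.mul_prod (integrable_const (∫ y : ℝ × ℝ, |h y|)))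
      ((((continuous_ofReal.comp (hh.comp continuous_fst)).mul
        (hΦc.comp continuous_snd)).mul he).mul
          ((continuous_conj.comp hgc).comp continuous_snd)).aestronglyMeasurable ?_
    filter_upwards [hae1] with ⟨y, p⟩ hz
    simp only [Function.uncurry_apply_pair, norm_mul, Complex.norm_real, Real.norm_eq_abs, he1,
      Complex.norm_conj, mul_one]
    exact mul_le_mul (mul_le_of_le_one_right (abs_nonneg _) hz) (hgb p) (norm_nonneg _)
      (abs_nonneg _)
  calc _ = ∫ y : ℝ × ℝ, ∫ p, (h y : ℂ) * Φ p * e y p *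
          conj (∫ y' : ℝ × ℝ, (h y' : ℂ) * e y' p) ∂μ := by
        congr 1 with y
        rw [integral_integral_swap (hI1 y)]
        congr 1 with p
        rw [← integral_conj, ← integral_const_mul]
        congr 1 with y'
        simp only [map_mul, Complex.conj_ofReal]
        ring
    _ = ∫ p, (∫ y : ℝ × ℝ, (h y : ℂ) * Φ p * e y p *
          conj (∫ y' : ℝ × ℝ, (h y' : ℂ) * e y' p)) ∂μ := integral_integral_swap hI2
    _ = _ := by
        congr 1 with p
        have : ∀ y : ℝ × ℝ, (h y : ℂ) * Φ p * e y p * conj (∫ y' : ℝ × ℝ, (h y' : ℂ) * e y' p) =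
            (Φ p * conj (∫ y' : ℝ × ℝ, (h y' : ℂ) * e y' p)) * ((h y : ℂ) * e y p) :=
          fun y => by ring
        simp_rw [this]
        rw [integral_const_mul, mul_assoc, Complex.conj_mul']
        push_cast
        ring

/-- **(4) Planar Laplace–Fourier representation of the smear** along the axis, from the axis
representation of `K` (see the module docstring): `ν_ε = |ĥ ∘ p_⊥|² · μ_ε`. -/
theorem smear_rep (K : EuclideanSpace ℝ (Fin 4) → ℝ)
    (hrep : ∀ ε : ℝ, 0 < ε → ∃ μ : Measure (EuclideanSpace ℝ (Fin 4)), IsFiniteMeasure μ ∧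
      μ {p | p 0 < 0} = 0 ∧ ∀ t : ℝ, 0 ≤ t → ∀ a : EuclideanSpace ℝ (Fin 4), a 0 = 0 →
        ((K (EuclideanSpace.single 0 (ε + t) + a) : ℝ) : ℂ) =
          ∫ p, cexp (((-(t * p 0) : ℝ) : ℂ) + ((⟪a, p⟫_ℝ : ℝ) : ℂ) * I) ∂μ)
    (h : ℝ × ℝ → ℝ) (hh : Continuous h) (hhs : HasCompactSupport h) :
    ∀ ε : ℝ, 0 < ε → ∃ ν : Measure (EuclideanSpace ℝ (Fin 4)), IsFiniteMeasure ν ∧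
      ν {p | p 0 < 0} = 0 ∧ ∀ t : ℝ, 0 ≤ t → ∀ b : ℝ,
        (((∫ y : ℝ × ℝ, ∫ y' : ℝ × ℝ, h y * h y' *
            K (WithLp.toLp 2 ![(ε + t, b).1, (ε + t, b).2, (y - y').1, (y - y').2])) : ℝ) : ℂ) =
          ∫ p, cexp ((((-(t * p 0) : ℝ)) : ℂ) + ((b * p 1 : ℝ) : ℂ) * I) ∂ν := by
  intro ε hε
  obtain ⟨μ, hfin, hμ0, hK⟩ := hrep ε hε
  have he : Continuous fun q : (ℝ × ℝ) × EuclideanSpace ℝ (Fin 4) =>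
      cexp (((q.1.1 * q.2 2 + q.1.2 * q.2 3 : ℝ) : ℂ) * I) := by fun_prop
  obtain ⟨hgc, hgb⟩ := transform_continuous
    (e := fun (y : ℝ × ℝ) (p : EuclideanSpace ℝ (Fin 4)) =>
      cexp (((y.1 * p 2 + y.2 * p 3 : ℝ) : ℂ) * I)) he (fun _ _ => norm_exp_ofReal_mul_I _) hh hhs
  have hwm : Measurable fun p : EuclideanSpace ℝ (Fin 4) => ENNReal.ofReal
      (‖∫ y : ℝ × ℝ, (h y : ℂ) * cexp (((y.1 * p 2 + y.2 * p 3 : ℝ) : ℂ) * I)‖ ^ 2) :=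
    (hgc.norm.pow 2).measurable.ennreal_ofReal
  refine ⟨μ.withDensity fun p => ENNReal.ofReal
      (‖∫ y : ℝ × ℝ, (h y : ℂ) * cexp (((y.1 * p 2 + y.2 * p 3 : ℝ) : ℂ) * I)‖ ^ 2), ?_,
    withDensity_absolutelyContinuous μ _ hμ0, fun t ht b => ?_⟩
  · refine isFiniteMeasure_withDensity_ofReal ((integrable_const ((∫ y : ℝ × ℝ, |h y|) ^ 2)).mono'
      (hgc.norm.pow 2).aestronglyMeasurable (ae_of_all _ fun p => ?_)).hasFiniteIntegral
    rw [Real.norm_eq_abs, abs_of_nonneg (sq_nonneg _)]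
    exact pow_le_pow_left₀ (norm_nonneg _) (hgb p) 2
  have hΦb : ∀ᵐ p ∂μ, ‖cexp (((-(t * p 0) : ℝ) : ℂ) + ((b * p 1 : ℝ) : ℂ) * I)‖ ≤ 1 := by
    have hae : ∀ᵐ p ∂μ, 0 ≤ p 0 := ae_iff.2 (by simpa only [not_le] using hμ0)
    filter_upwards [hae] with p hp
    rw [Complex.norm_exp, Real.exp_le_one_iff]
    simp only [Complex.add_re, Complex.ofReal_re, Complex.mul_re, Complex.I_re,
      Complex.ofReal_im, Complex.I_im, mul_zero, mul_one, sub_self, add_zero]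
    nlinarith
  have hpt : ∀ y y' : ℝ × ℝ,
      ((h y * h y' * K (WithLp.toLp 2 ![ε + t, b, (y - y').1, (y - y').2]) : ℝ) : ℂ) =
        ∫ p, (h y : ℂ) * (h y' : ℂ) * (cexp (((-(t * p 0) : ℝ) : ℂ) + ((b * p 1 : ℝ) : ℂ) * I) *
          cexp (((y.1 * p 2 + y.2 * p 3 : ℝ) : ℂ) * I) *
          conj (cexp (((y'.1 * p 2 + y'.2 * p 3 : ℝ) : ℂ) * I))) ∂μ := by
    intro y y'
    push_cast
    rw [pt_eq_single_add, hK t ht _ (by simp), ← integral_const_mul]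
    congr 1 with p
    rw [inner_pt0, ← Complex.exp_conj, ← Complex.exp_add, ← Complex.exp_add]
    congr 2
    simp only [map_mul, map_add, Complex.conj_ofReal, Complex.conj_I, Prod.fst_sub, Prod.snd_sub]
    push_cast
    ring
  dsimp only
  rw [← integral_complex_ofReal]
  simp_rw [← integral_complex_ofReal, hpt]
  rw [fubini_core μ (by fun_prop) hΦb he (fun _ _ => norm_exp_ofReal_mul_I _) hh hhs,
    integral_withDensity_eq_integral_toReal_smul hwm
      (ae_of_all _ fun _ => ENNReal.ofReal_lt_top)]
  congr 1 with p
  rw [ENNReal.toReal_ofReal (sq_nonneg _), Complex.real_smul, mul_comm]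

end SmearTransport

/-- **Stub 3 · transverse smearing transports everything to the plane** (line
`transverse-smearing-planar-threshold` of crux `ShellRigidity`, stmt-QuantumFields-11685),
LET-FREE RESTATEMENT (the smear `F` is a variable with its defining equation `hF`, so that the
registered source signature contains no `:=`): for `K` continuous off `0` with
`|K x| ≤ C(1 + ‖x‖^(η-10))`, `0 < η < 8`, invariant under the swap of coordinates `0,1`, under
`x₁ ↦ -x₁`, `x₀ ↦ -x₀`, and with the axis Laplace–Fourier representations, and for `h ∈ C_c(ℝ²)`,
`F(t,s) = ∫∫ h y h y' K(t, s, y - y')` is continuous off `0`, of order `8 - η`, `D₄`-symmetric, and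
represented along the axis by finite measures null on `{p₀ < 0}`. -/
theorem stub_smearTransport (K : EuclideanSpace ℝ (Fin 4) → ℝ) (η : ℝ) (hη : 0 < η)
    (hη8 : η < 8) (hc : ContinuousOn K {x | x ≠ 0})
    (hb : ∃ C : ℝ, ∀ x : EuclideanSpace ℝ (Fin 4), x ≠ 0 → |K x| ≤ C * (1 + ‖x‖ ^ (η - 10)))
    (hswap : ∀ x y : EuclideanSpace ℝ (Fin 4),
      y 0 = x 1 → y 1 = x 0 → y 2 = x 2 → y 3 = x 3 → K y = K x)
    (hneg1 : ∀ x y : EuclideanSpace ℝ (Fin 4),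
      y 0 = x 0 → y 1 = -x 1 → y 2 = x 2 → y 3 = x 3 → K y = K x)
    (hθ : ∀ x y : EuclideanSpace ℝ (Fin 4),
      y 0 = -x 0 → y 1 = x 1 → y 2 = x 2 → y 3 = x 3 → K y = K x)
    (hrep : ∀ ε : ℝ, 0 < ε → ∃ μ : Measure (EuclideanSpace ℝ (Fin 4)), IsFiniteMeasure μ ∧
      μ {p | p 0 < 0} = 0 ∧
      ∀ t : ℝ, 0 ≤ t → ∀ a : EuclideanSpace ℝ (Fin 4), a 0 = 0 →
        ((K (EuclideanSpace.single 0 (ε + t) + a) : ℝ) : ℂ) =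
          ∫ p, cexp (((-(t * p 0) : ℝ) : ℂ) + ((⟪a, p⟫_ℝ : ℝ) : ℂ) * I) ∂μ)
    (h : ℝ × ℝ → ℝ) (hh : Continuous h) (hhs : HasCompactSupport h) (F : ℝ × ℝ → ℝ)
    (hF : ∀ x : ℝ × ℝ, F x = ∫ y : ℝ × ℝ, ∫ y' : ℝ × ℝ,
      h y * h y' * K (WithLp.toLp 2 ![x.1, x.2, (y - y').1, (y - y').2])) :
    ContinuousOn F {x | x ≠ 0} ∧
    (∃ C : ℝ, ∀ x : ℝ × ℝ, x ≠ 0 → |F x| ≤ C * (1 + (x.1 ^ 2 + x.2 ^ 2) ^ (-((8 - η) / 2)))) ∧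
    (∀ t s : ℝ, F (t, s) = F (s, t) ∧ F (t, s) = F (t, -s) ∧ F (t, s) = F (-t, s)) ∧
    (∀ ε : ℝ, 0 < ε → ∃ ν : Measure (EuclideanSpace ℝ (Fin 4)), IsFiniteMeasure ν ∧
      ν {p | p 0 < 0} = 0 ∧
      ∀ t : ℝ, 0 ≤ t → ∀ b : ℝ, ((F (ε + t, b) : ℝ) : ℂ) =
        ∫ p, cexp ((((-(t * p 0) : ℝ)) : ℂ) + ((b * p 1 : ℝ) : ℂ) * I) ∂ν) := by
  have _ := hη -- `η > 0` is carried by the registered signature (it makes the order `8 - η < 8`)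
  obtain rfl : F = fun x => ∫ y : ℝ × ℝ, ∫ y' : ℝ × ℝ,
      h y * h y' * K (WithLp.toLp 2 ![x.1, x.2, (y - y').1, (y - y').2]) := funext hF
  refine ⟨SmearTransport.smear_continuousOn K hc h hh hhs,
    SmearTransport.smear_bound K η hη8 hb h hh hhs, fun t s => ⟨?_, ?_, ?_⟩,
    SmearTransport.smear_rep K hrep h hh hhs⟩ <;> dsimp only <;> congr 1 with y <;>
    congr 1 with y'
  · rw [hswap (WithLp.toLp 2 ![s, t, (y - y').1, (y - y').2])
      (WithLp.toLp 2 ![t, s, (y - y').1, (y - y').2]) (by simp) (by simp) (by simp) (by simp)]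
  · rw [hneg1 (WithLp.toLp 2 ![t, -s, (y - y').1, (y - y').2])
      (WithLp.toLp 2 ![t, s, (y - y').1, (y - y').2]) (by simp) (by simp) (by simp) (by simp)]
  · rw [hθ (WithLp.toLp 2 ![-t, s, (y - y').1, (y - y').2])
      (WithLp.toLp 2 ![t, s, (y - y').1, (y - y').2]) (by simp) (by simp) (by simp) (by simp)]

end Summit.QuantumFields.YangMills.Cruxes.ShellRigidity.TransverseSmearingPlanarThreshold

end
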